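import Summits.HodgeConjecture.HodgeConjecture.Theorems.F0P6aEmbeddingTorsorPlaces        -- ★ torsor `structural_comp_bijective`, `ker_residue_restrict_structural_comp_algEquiv` (+ ★ p847313)
import Literature.NumberTheory.ComplexMultiplication.CMTypePrimeProductFrobeniusShape     -- ★ `prod_univ_smul_asIdeal_eq_span_absNorm`
import HarnessLib

/-!
# Crux `HLiu418` — P6 sub-line **F0-P6a**, P-line organ for `stub_TWIST` (ARITHMETIC HALF): the twist ideal of a Frobenius
# at the adapted frame — `(p^{f_w}) = 𝔞 · c•𝔞`, `𝔭_w ∣ 𝔞`, `𝔞 + (N) = (1)`, `𝔞 ≠ 0` for `𝔞 := ∏_{τ ∈ Φ_w} ker (residue ∘ τR τ)`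

Cell `hodgecm-mathlib`, crux `stmt-HodgeConjecture-24832` (HLiu418), sub-line P6a; «L4» LA4-p03 (g0), LA4-plan DEAL v1 organ #2
(`--supports stmt-HodgeConjecture-24832`, count-neutral).  THEOREMS ONLY (no definition, no instance, no notation, no named fact, no `sorry`).
CONSUMER: the rows (a) `Ideal.span {(twistNorm γ : 𝓞 F)} = twistIdeal γ * c • twistIdeal γ`, (b) `twistIdeal γ ⊔ Ideal.span {(N : 𝓞 F)} = ⊤`,
(c) `twistIdeal γ ≠ ⊥`, (FROB-𝔞) `w.asIdeal ∣ twistIdeal γ`, (FROB-n) `twistNorm γ = pChar ^ fDeg` of the P-LINE `Lines/F0_P6a_PELInputs.lean`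
ED. 1 `PELTwistLawAt` (:209–:245) ∕ the E-currency letter `ETwistAt` of the leaf `Lines/F0_P6a_PELSpread.lean` (LA4-plan cand `F0_P6a_EReadings`),
at a Frobenius-reading `γ = γ_σ`, with the instantiation named by LA4-plan (02:09:01Z): **`twistIdeal γ_σ := ∏_{τ ∈ Φ_w} ker (residue ∘ τR τ)`**
(the CM-type product of the primes induced by the `p`-adic frame `Φ_w`, ★ p847313 `exists_cmType_adapted`) and `twistNorm γ_σ := pChar ^ fDeg`.
HC_CM is proved only modulo the printed citations (2 remaining named inputs hLiu418 24832, h413 24833) until rung 0 closes; nothing here is about HC.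

THE MATHEMATICS ([Shimura1998] §8.3 Prop. 29 («`𝔟𝔟^ρ = N_{K*∕ℚ}(𝔞)𝔬_F`» for the type norm, via `G = S* ∪ S*ρ`), §8.4 (1) (the Galois case
`S* = S⁻¹`), §13.1 Thm. 1 and (7) (the Frobenius of a CM abelian variety generates the type norm of the prime); [NeukirchANT1999] Ch. I (9.1)
(conjugate primes), Ch. III §1 (1.6) (iv)).  Let `F` be a CM field, Galois over `ℚ`, `w` a finite place, `F̄_w` an algebraic closure of `F_w` with
valuation ring `R` (★ `closureValuationSubring`), `τR τ : 𝓞 F → R` the restrictions of the embeddings `τ : F → F̄_w` (★ p847313 `exists_restrict`) and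
`𝔭_τ := ker (residue_R ∘ τR τ)` the prime INDUCED by `τ` (so `𝔭_{τ_w} = 𝔭_w`, `𝔭_{τ∘c} = c•𝔭_τ`, ★ p847313 §2; `𝔭_{τ_w ∘ g} = 𝔭_{g⁻¹ • w}` along the
TORSOR `g ↦ τ_w ∘ g`, ★ `F0P6aEmbeddingTorsorPlaces`).  (§1) Hence `∏_{all τ} 𝔭_τ = ∏_{g} 𝔭_{g • w} = (N 𝔭_w)` (★
`CMTypePrimeProductFrobeniusShape.prod_univ_smul_asIdeal_eq_span_absNorm`), and for a CM type `Φ` of embeddings (`τ ∈ Φ ↔ τ∘c ∉ Φ`) the type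
product `𝔞 := ∏_{τ ∈ Φ} 𝔭_τ` has `𝔞 · c•𝔞 = ∏_{τ ∈ Φ} 𝔭_τ · ∏_{τ ∈ Φc} 𝔭_τ = ∏_{all τ} 𝔭_τ = (N 𝔭_w)`.  (§2) With `N 𝔭_w = N 𝔭_{c•w} = p^{f_w}`:
row (a); `𝔭_w ∣ 𝔞` when `τ_w ∈ Φ` (FROB-𝔞); every factor is a maximal ideal `𝔭_{g⁻¹ w} ∋ p`, so `𝔞 ≠ 0` (c) and `𝔞 + (N) = (1)` for `p ∤ N` (b).
Adaptedness of the frame (★ `KottAdaptedAt`) is NOT used: only «CM type through `τ_w`».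

MAIN STATEMENTS.  §1 **`prod_univ_ker_residue_restrict_eq_span_absNorm`**, `complexConj_smul_prod_ker_residue_restrict`,
**`prod_mul_complexConj_smul_prod_eq_prod_univ`**; §2 **`span_pow_eq_prod_mul_complexConj_smul_prod`** (row (a)), `asIdeal_dvd_prod_ker_residue_restrict`
(FROB-𝔞), `prod_ker_residue_restrict_ne_bot` (c), `prod_ker_residue_restrict_sup_span_eq_top` (b), and the packaged HEAD **`exists_frobeniusTwistIdeal`**
(one `obtain` for the `ETwistAt` payer: binders `τR hτR Φ h₀ hcm hp hpw hf` = ★ `exists_restrict` + ★ `exists_cmType_adapted` + the spread՚s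
`hpChar`∕`hfDeg` rows).

[cite: Shimura1998, §8.3 Prop. 29; §8.4 (1); §13.1 Theorem 1 and (7); §18.6 Thm. 18.6 pp. 124–125]
[cite: NeukirchANT1999, Ch. I (9.1); Ch. II (8.1); Ch. III §1 (1.6) Prop. (iv)] [cite: RapoportSmithlingZhang2020Diagonal, §3.2 p. 10; §4.1 (4.6) p. 16 and p. 17]
-/

set_option autoImplicit false

-- `Summit.HodgeConjecture.HodgeConjecture.…` repeats `HodgeConjecture` by design (D-0017).
set_option linter.dupNamespace false

noncomputable section

open NumberField IsDedekindDomain IsLocalRing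
open scoped Pointwise
open Literature.NumberTheory.GaloisRepresentations (closureValuationSubring)
open Literature.NumberTheory.Automorphic Literature.NumberTheory.ComplexMultiplication
open Summit.HodgeConjecture.HodgeConjecture.Theorems.F0P6aKottwitzCountAtSplitPlace
open Summit.HodgeConjecture.HodgeConjecture.Theorems.F0P6aEmbeddingTorsorPlaces

namespace Summit.HodgeConjecture.HodgeConjecture.Theorems.F0P6aFrobeniusTwistIdealAtSplitPlace

variable {F : Type} [Field F] [NumberField F] [IsCMField F] (w : HeightOneSpectrum (𝓞 F))

/-! ### §1 The products: all embeddings, and a `c`-CM type of embeddings -/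

section Products

variable (τR : (F →+* AlgebraicClosure (w.adicCompletion F)) → (𝓞 F →+* ↥(closureValuationSubring (w.adicCompletion F))))
  (hτR : ∀ (τ : F →+* AlgebraicClosure (w.adicCompletion F)) (x : 𝓞 F),
    ((τR τ x : ↥(closureValuationSubring (w.adicCompletion F))) : AlgebraicClosure (w.adicCompletion F)) = τ (x : F))

include hτR

omit [IsCMField F] in
/-- **`∏_{τ : F → F̄_w} 𝔭_τ = (N 𝔭_w)`**: over ALL embeddings the induced primes multiply to the ideal generated by the residue cardinality
`q = N 𝔭_w` — the dictionary `τ_w ∘ g ↦ 𝔭_{g⁻¹ w}` (★ `F0P6aEmbeddingTorsorPlaces`) turns the product into `∏_{g ∈ Gal(F∕ℚ)} 𝔭_{g • w}`, which is ★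
`prod_univ_smul_asIdeal_eq_span_absNorm` ([NeukirchANT1999] III (1.6) (iv) at base `ℚ`). [cite: NeukirchANT1999, Ch. I (9.1); Ch. III §1 (1.6) Prop. (iv)] -/
theorem prod_univ_ker_residue_restrict_eq_span_absNorm [IsGalois ℚ F] :
    ∏ τ : F →+* AlgebraicClosure (w.adicCompletion F), RingHom.ker ((residue ↥(closureValuationSubring (w.adicCompletion F))).comp (τR τ)) =
      Ideal.span {((Ideal.absNorm w.asIdeal : ℕ) : 𝓞 F)} := by
  -- reindex by the torsor `g ↦ τ_w ∘ g`
  have h1 := Fintype.prod_bijective _ (structural_comp_bijective w)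
    (fun g => RingHom.ker ((residue ↥(closureValuationSubring (w.adicCompletion F))).comp
      (τR (((algebraMap (w.adicCompletion F) (AlgebraicClosure (w.adicCompletion F))).comp
        (algebraMap F (w.adicCompletion F))).comp (g : F →+* F)))))
    (fun τ => RingHom.ker ((residue ↥(closureValuationSubring (w.adicCompletion F))).comp (τR τ))) (fun _ => rfl)
  rw [← h1]
  simp_rw [ker_residue_restrict_structural_comp_algEquiv w τR hτR]
  -- reindex by inversion, then ★
  rw [← prod_univ_smul_asIdeal_eq_span_absNorm w]
  exact Fintype.prod_equiv (Equiv.inv (F ≃ₐ[ℚ] F)) _ _ fun g => rfl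

/-- **`c • ∏_{τ ∈ Φ} 𝔭_τ = ∏_{τ ∈ Φ} 𝔭_{τ ∘ c}`** (★ `ker_residue_restrict_comp_complexConj`: conjugation moves the induced prime).
[cite: RapoportSmithlingZhang2020Diagonal, §3.2 p. 10] [cite: NeukirchANT1999, Ch. II (8.1)] -/
theorem complexConj_smul_prod_ker_residue_restrict (Φ : Finset (F →+* AlgebraicClosure (w.adicCompletion F))) :
    (IsCMField.complexConj F) • ∏ τ ∈ Φ, RingHom.ker ((residue ↥(closureValuationSubring (w.adicCompletion F))).comp (τR τ)) =
      ∏ τ ∈ Φ, RingHom.ker ((residue ↥(closureValuationSubring (w.adicCompletion F))).comp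
        (τR (τ.comp ((IsCMField.complexConj F : F ≃ₐ[↥(maximalRealSubfield F)] F) : F →+* F)))) := by
  rw [Finset.smul_prod']
  exact Finset.prod_congr rfl fun τ _ => (ker_residue_restrict_comp_complexConj w τR hτR τ).symm

/-- **THE CM-TYPE PRODUCT TIMES ITS CONJUGATE IS THE FULL PRODUCT**: for a CM type `Φ` of embeddings `F → F̄_w` (`τ ∈ Φ ↔ τ ∘ c ∉ Φ`),
`(∏_{τ ∈ Φ} 𝔭_τ) · c•(∏_{τ ∈ Φ} 𝔭_τ) = ∏_{all τ} 𝔭_τ` (`Φ ∘ c` is the complement of `Φ`). The mechanism of [Shimura1998] §8.3 Prop. 29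
(«`G = S* ∪ S*ρ`», `𝔟𝔟^ρ = N(𝔞)`), read on the `p`-adic embeddings. [cite: Shimura1998, §8.3 Prop. 29; §8.4 (1)] -/
theorem prod_mul_complexConj_smul_prod_eq_prod_univ (Φ : Finset (F →+* AlgebraicClosure (w.adicCompletion F)))
    (hcm : ∀ τ, τ ∈ Φ ↔ τ.comp ((IsCMField.complexConj F : F ≃ₐ[↥(maximalRealSubfield F)] F) : F →+* F) ∉ Φ) :
    (∏ τ ∈ Φ, RingHom.ker ((residue ↥(closureValuationSubring (w.adicCompletion F))).comp (τR τ))) *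
        (IsCMField.complexConj F) • ∏ τ ∈ Φ, RingHom.ker ((residue ↥(closureValuationSubring (w.adicCompletion F))).comp (τR τ)) =
      ∏ τ : F →+* AlgebraicClosure (w.adicCompletion F), RingHom.ker ((residue ↥(closureValuationSubring (w.adicCompletion F))).comp (τR τ)) := by
  classical
  rw [complexConj_smul_prod_ker_residue_restrict w τR hτR Φ]
  -- `τ ↦ τ ∘ c` is injective and carries `Φ` onto its complement
  have hinj : Function.Injective fun τ : F →+* AlgebraicClosure (w.adicCompletion F) =>
      τ.comp ((IsCMField.complexConj F : F ≃ₐ[↥(maximalRealSubfield F)] F) : F →+* F) := by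
    intro τ₁ τ₂ h
    have h' := congrArg (fun τ : F →+* AlgebraicClosure (w.adicCompletion F) =>
      τ.comp ((IsCMField.complexConj F : F ≃ₐ[↥(maximalRealSubfield F)] F) : F →+* F)) h
    simpa only [comp_complexConj_comp_complexConj] using h'
  have himage : Φ.image (fun τ : F →+* AlgebraicClosure (w.adicCompletion F) =>
      τ.comp ((IsCMField.complexConj F : F ≃ₐ[↥(maximalRealSubfield F)] F) : F →+* F)) = Φᶜ := by
    ext τ
    rw [Finset.mem_image, Finset.mem_compl]
    constructor
    · rintro ⟨τ', hτ', rfl⟩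
      exact (hcm τ').mp hτ'
    · intro hτ
      exact ⟨τ.comp ((IsCMField.complexConj F : F ≃ₐ[↥(maximalRealSubfield F)] F) : F →+* F),
        (hcm _).mpr (by rwa [comp_complexConj_comp_complexConj]), comp_complexConj_comp_complexConj τ⟩
  rw [← Finset.prod_image (f := fun τ => RingHom.ker ((residue ↥(closureValuationSubring (w.adicCompletion F))).comp (τR τ)))
    (fun τ₁ _ τ₂ _ h => hinj h), himage, Finset.prod_mul_prod_compl]

end Products

/-! ### §2 THE ROWS of `ETwistAt` ∕ `PELTwistLawAt` at a Frobenius: `(a)` norm, `(b)` prime to the level, `(c)` non-zero, `(FROB-𝔞)` -/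

section Head

variable [IsGalois ℚ F]
  (τR : (F →+* AlgebraicClosure (w.adicCompletion F)) → (𝓞 F →+* ↥(closureValuationSubring (w.adicCompletion F))))
  (hτR : ∀ (τ : F →+* AlgebraicClosure (w.adicCompletion F)) (x : 𝓞 F),
    ((τR τ x : ↥(closureValuationSubring (w.adicCompletion F))) : AlgebraicClosure (w.adicCompletion F)) = τ (x : F))
  (Φ : Finset (F →+* AlgebraicClosure (w.adicCompletion F)))

include hτR

/-- **ROW (a) with (FROB-n): `(p^{f_w}) = 𝔞 · c•𝔞`** for the CM-type product `𝔞 = ∏_{τ ∈ Φ} 𝔭_τ` of a CM type `Φ` of embeddings `F → F̄_w`, where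
`p^{f_w} = N 𝔭_{c•w} = N 𝔭_w` is the residue cardinality (the spread՚s row `hfDeg`): §1 + ★ `card_quotient_smul`.
[cite: Shimura1998, §8.3 Prop. 29; §13.1 Theorem 1 and (7)] [cite: NeukirchANT1999, Ch. III §1 (1.6) Prop. (iv)] -/
theorem span_pow_eq_prod_mul_complexConj_smul_prod
    (hcm : ∀ τ, τ ∈ Φ ↔ τ.comp ((IsCMField.complexConj F : F ≃ₐ[↥(maximalRealSubfield F)] F) : F →+* F) ∉ Φ)
    {p f : ℕ} (hf : Nat.card (𝓞 F ⧸ ((IsCMField.complexConj F) • w).asIdeal) = p ^ f) :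
    Ideal.span {((p ^ f : ℕ) : 𝓞 F)} =
      (∏ τ ∈ Φ, RingHom.ker ((residue ↥(closureValuationSubring (w.adicCompletion F))).comp (τR τ))) *
        (IsCMField.complexConj F) • ∏ τ ∈ Φ, RingHom.ker ((residue ↥(closureValuationSubring (w.adicCompletion F))).comp (τR τ)) := by
  rw [prod_mul_complexConj_smul_prod_eq_prod_univ w τR hτR Φ hcm, prod_univ_ker_residue_restrict_eq_span_absNorm w τR hτR,
    Ideal.absNorm_apply, Submodule.cardQuot_apply, ← HeightOneSpectrum.card_quotient_smul (IsCMField.complexConj F) w, hf]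

omit [IsCMField F] [IsGalois ℚ F] in
/-- **ROW (FROB-𝔞): `𝔭_w ∣ 𝔞`** as soon as the structural embedding `τ_w` belongs to `Φ` (a frame THROUGH `τ_w`): its factor is `𝔭_{τ_w} = 𝔭_w`
(★ `ker_residue_restrict_structural`). [cite: Shimura1998, §13.1 Theorem 1 and (7)] [cite: NeukirchANT1999, Ch. II (8.1)] -/
theorem asIdeal_dvd_prod_ker_residue_restrict
    (h₀ : (algebraMap (w.adicCompletion F) (AlgebraicClosure (w.adicCompletion F))).comp (algebraMap F (w.adicCompletion F)) ∈ Φ) :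
    w.asIdeal ∣ ∏ τ ∈ Φ, RingHom.ker ((residue ↥(closureValuationSubring (w.adicCompletion F))).comp (τR τ)) := by
  rw [← ker_residue_restrict_structural w τR hτR]
  exact Finset.dvd_prod_of_mem _ h₀

omit [IsCMField F] in
/-- **ROW (c): `𝔞 ≠ 0`** — every factor is a conjugate prime `𝔭_{g⁻¹ w}` (★ torsor). [cite: NeukirchANT1999, Ch. I (9.1)] -/
theorem prod_ker_residue_restrict_ne_bot :
    ∏ τ ∈ Φ, RingHom.ker ((residue ↥(closureValuationSubring (w.adicCompletion F))).comp (τR τ)) ≠ ⊥ := by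
  rw [Ne, ← Ideal.zero_eq_bot, Finset.prod_eq_zero_iff]
  rintro ⟨τ, -, hτ⟩
  obtain ⟨g, hg⟩ := (structural_comp_bijective w).2 τ
  dsimp only at hg
  rw [← hg, ker_residue_restrict_structural_comp_algEquiv w τR hτR g, Ideal.zero_eq_bot] at hτ
  exact (g⁻¹ • w).ne_bot hτ

omit [IsCMField F] in
/-- **ROW (b): `𝔞 + (N) = (1)` for every level `N` prime to `p`** (`p ∈ 𝔭_w` the residue characteristic): every factor `𝔭_{g⁻¹ w}` is a maximal
ideal containing `p`, so it cannot contain `N`. [cite: Shimura1998, §18.6 Thm. 18.6 pp. 124–125] [cite: NeukirchANT1999, Ch. I (9.1)] -/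
theorem prod_ker_residue_restrict_sup_span_eq_top {p : ℕ} (hp : p.Prime) (hpw : (p : 𝓞 F) ∈ w.asIdeal) {N : ℕ} (hN : ¬ p ∣ N) :
    (∏ τ ∈ Φ, RingHom.ker ((residue ↥(closureValuationSubring (w.adicCompletion F))).comp (τR τ))) ⊔ Ideal.span {((N : ℕ) : 𝓞 F)} = ⊤ := by
  apply Ideal.prod_sup_eq_top
  intro τ _
  obtain ⟨g, hg⟩ := (structural_comp_bijective w).2 τ
  dsimp only at hg
  rw [← hg, ker_residue_restrict_structural_comp_algEquiv w τR hτR g]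
  -- `𝔭_{g⁻¹ w}` is maximal and contains `p`; `p, N` are coprime
  have hmax : (g⁻¹ • w).asIdeal.IsMaximal := (g⁻¹ • w).isMaximal
  have hpmem : (p : 𝓞 F) ∈ (g⁻¹ • w).asIdeal := by
    rw [HeightOneSpectrum.smul_asIdeal, Ideal.mem_inv_pointwise_smul_iff]
    have hgp : g • (p : 𝓞 F) = p := map_natCast (MulSemiringAction.toRingHom (F ≃ₐ[ℚ] F) (𝓞 F) g) p
    rwa [hgp]
  by_contra hne
  have hle : Ideal.span {((N : ℕ) : 𝓞 F)} ≤ (g⁻¹ • w).asIdeal := by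
    have := hmax.eq_of_le (J := (g⁻¹ • w).asIdeal ⊔ Ideal.span {((N : ℕ) : 𝓞 F)}) hne le_sup_left
    exact this ▸ le_sup_right
  have hNmem : ((N : ℕ) : 𝓞 F) ∈ (g⁻¹ • w).asIdeal := hle (Ideal.mem_span_singleton_self _)
  have hcop : IsCoprime ((p : ℤ) : 𝓞 F) ((N : ℤ) : 𝓞 F) :=
    (Nat.isCoprime_iff_coprime.mpr (hp.coprime_iff_not_dvd.mpr hN)).map (Int.castRingHom (𝓞 F))
  rw [Int.cast_natCast, Int.cast_natCast] at hcop
  obtain ⟨a, b, hab⟩ := hcop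
  apply hmax.ne_top
  rw [Ideal.eq_top_iff_one, ← hab]
  exact Ideal.add_mem _ (Ideal.mul_mem_left _ _ hpmem) (Ideal.mul_mem_left _ _ hNmem)

/-- **THE TWIST IDEAL OF A FROBENIUS AT THE ADAPTED FRAME (HEAD).**  For a CM field `F`, Galois over `ℚ`, a finite place `w` with residue
characteristic `p` and `N 𝔭_{c•w} = p^{f}` (the spread՚s rows `hpChar`, `hfDeg`), any family of restrictions `τR` (★ `exists_restrict`) and a CM
type `Φ` of embeddings `F → F̄_w` THROUGH the structural `τ_w` (★ `exists_cmType_adapted`, first two conjuncts — adaptedness is not needed), the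
ideal **`𝔞 := ∏_{τ ∈ Φ} ker (residue ∘ τR τ)`** («type norm of `𝔭_w`») satisfies the rows of `ETwistAt` ∕ `PELTwistLawAt` at a Frobenius-reading
`γ` with `twistNorm γ := p ^ f`: (a) `(p^f) = 𝔞 · c•𝔞`, (b) `𝔞 + (N) = (1)` for every `N` prime to `p`, (c) `𝔞 ≠ 0`, (FROB-𝔞) `𝔭_w ∣ 𝔞` (and
(FROB-n) by definition). [cite: Shimura1998, §8.3 Prop. 29; §13.1 Theorem 1 and (7); §18.6 Thm. 18.6 pp. 124–125]
[cite: NeukirchANT1999, Ch. I (9.1); Ch. III §1 (1.6) Prop. (iv)] [cite: RapoportSmithlingZhang2020Diagonal, §4.1 (4.6) p. 16 and p. 17] -/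
theorem exists_frobeniusTwistIdeal
    (h₀ : (algebraMap (w.adicCompletion F) (AlgebraicClosure (w.adicCompletion F))).comp (algebraMap F (w.adicCompletion F)) ∈ Φ)
    (hcm : ∀ τ, τ ∈ Φ ↔ τ.comp ((IsCMField.complexConj F : F ≃ₐ[↥(maximalRealSubfield F)] F) : F →+* F) ∉ Φ)
    {p f : ℕ} (hp : p.Prime) (hpw : (p : 𝓞 F) ∈ w.asIdeal) (hf : Nat.card (𝓞 F ⧸ ((IsCMField.complexConj F) • w).asIdeal) = p ^ f) :
    ∃ 𝔞 : Ideal (𝓞 F), 𝔞 = ∏ τ ∈ Φ, RingHom.ker ((residue ↥(closureValuationSubring (w.adicCompletion F))).comp (τR τ)) ∧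
      Ideal.span {((p ^ f : ℕ) : 𝓞 F)} = 𝔞 * (IsCMField.complexConj F) • 𝔞 ∧
      (∀ N : ℕ, ¬ p ∣ N → 𝔞 ⊔ Ideal.span {((N : ℕ) : 𝓞 F)} = ⊤) ∧
      𝔞 ≠ ⊥ ∧ w.asIdeal ∣ 𝔞 :=
  ⟨_, rfl, span_pow_eq_prod_mul_complexConj_smul_prod w τR hτR Φ hcm hf,
    fun _ hN => prod_ker_residue_restrict_sup_span_eq_top w τR hτR Φ hp hpw hN, prod_ker_residue_restrict_ne_bot w τR hτR Φ,
    asIdeal_dvd_prod_ker_residue_restrict w τR hτR Φ h₀⟩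

end Head

end Summit.HodgeConjecture.HodgeConjecture.Theorems.F0P6aFrobeniusTwistIdealAtSplitPlace

end
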